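import Mathlib
import HarnessLib
import Summits.Ventures.LatticeQCDFlow.Exactness.SphereLOFlowEntropyFloorExplicit
import Summits.Ventures.LatticeQCDFlow.Exactness.TorusConeGeometry
import Summits.Ventures.LatticeQCDFlow.Exactness.TorusLinkCouplingHypotheses

/-!
# The entropy floor on the periodic lattice `(ℤ/L)^ν`: for ANY family of mutually far-apart nearest-neighbour pairs, `KL((Φ_{0→c})_*π̄ ‖ e^{−cS}π̄/Z_c) ≥ (#pairs)·κ⁴β₀⁴c⁴/(4(d−1)d²(d+2)) − L^ν·(12κ²υ²/(d−1))·c²·τ_m(c)` at small flow time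

HONEST FRAMING: exact (Metropolis-corrected) sampling algorithms for lattice gauge theory;
figures of merit are autocorrelation/cost numbers at stated couplings and volumes; no
continuum-physics claim.

Venture `LatticeQCDFlow` (cell pub-lqcd), topic `Exactness`; FANOUT row 7 (`s0-cpn-null`: the
S0-D1 rung — 2D CP⁹ on periodic `L × L` lattices, Lüscher's LO trivializing map inside HMC).  NEW WORK
of the cell over this lineage's `Exactness/SphereLOFlowEntropyFloorSmallTime.lean` (the extensive
floor at small flow time, linear in the number of blocks) and `Exactness/TorusConeGeometry.lean` (cone
neighbourhoods of blocks on the torus have at most `|B|(2m+3)^ν` sites, box-apart blocks are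
separated, coupled pairs have no common neighbour for `L ≠ 3`); nothing is cited as a fact.  Printed
counterparts, NAMED ONLY: Engel–Schaefer, Comput. Phys. Commun. 182 (2011) 2107, §3; M. Lüscher,
Commun. Math. Phys. 293 (2010) 899; Abbott et al., Phys. Rev. D 106 (2022) 074506, §V.  THE BARRIER
ON THE RUNG'S OWN LATTICES: take the blocks to be the pairs themselves.  For the E–S / CP(N−1) action
on `(ℤ/L)^ν`, `L ≠ 3`, with nearest-neighbour scaled-isometric adjoint-pair transporters
(`‖U_{nm}v‖ = β_{nm}‖v‖`, `Σ_m‖U_{nm}‖ ≤ υ`, `d = dim E ≥ 2`), and ANY finite family of COUPLED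
nearest-neighbour pairs `{k_j, l_j}` (`U_{k_j l_j} ≠ 0`, `β_{k_j l_j} = β₀`) that are mutually
`Box(2m+2)`-apart, every flow time `0 ≤ c ≤ |T| + 1` small for `(n₀, I₀) = (1, 2(2m+3)^ν)` satisfies
`KL((Φ_{0→c})_*π̄ ‖ e^{−cS}π̄/Z_c) ≥ (#pairs)·A·c⁴/128 − L^ν·(12κ²υ²/(d−1))·c²·2e^{Kc}(Kc)^{m+1}/(m+1)!`,
`A = 32κ⁴β₀⁴/((d−1)d²(d+2))`, `K = 3|κ|υ/(d−1)` — e.g. one pair per `s × s` cell of an `L × L` torus with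
`s ≥ 2m+4`, `s ∣ L`, gives `#pairs = L²/s²`: LINEAR IN THE VOLUME at fixed small flow time, against a
cone tail of order `c^{m+3}`.

## Content

* **`torus_pairs_sub_le_klDiv_map_loFlow`** — the displayed inequality.

NOT CLAIMED: the existence / count of a box-apart pair family for given `L`, `s` (an arithmetic
exercise on `ℤ/L` left to the user); `L = 3`; ESS / acceptance ceilings or autocorrelations of the
Metropolis-corrected chain; numbers.

## Part II (merged here from the staged file `TorusLinkEntropyFloor.lean`, same lineage)

### The entropy floor for the model of record: the link-transported CP(N−1)/O(N) coupling on `(ℤ/L)^ν`, `L ≥ 4` — `KL((Φ_{0→c})_*π̄ ‖ e^{−cS}π̄/Z_c) ≥ (#far-apart links)·κ⁴c⁴/(4(d−1)d²(d+2)) − L^ν·(48ν²κ²/(d−1))·c²·τ_m(c)` at small flow time, with NO hypothesis left on the couplings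

HONEST FRAMING: exact (Metropolis-corrected) sampling algorithms for lattice gauge theory;
figures of merit are autocorrelation/cost numbers at stated couplings and volumes; no
continuum-physics claim.

Venture `LatticeQCDFlow` (cell pub-lqcd), topic `Exactness`; FANOUT row 7 (`s0-cpn-null`: the
S0-D1 rung — 2D CP⁹ on periodic `L × L` lattices, Lüscher's LO trivializing map inside HMC,
Engel–Schaefer 2011).  NEW WORK of the cell over Part I of this file
(the floor on `(ℤ/L)^ν` for far-apart coupled pairs of an abstract nearest-neighbour coupling) and
`Exactness/TorusLinkCouplingHypotheses.lean` (the torus link coupling has no self-coupling,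
nearest-neighbour support, isometric links and local weight `2ν`), with
`Exactness/SphereLOFlowLinks.lean` (adjoint pairs); nothing is cited as a fact.  Printed
counterparts, NAMED ONLY: Engel–Schaefer, Comput. Phys. Commun. 182 (2011) 2107, §2 eqs. (1),
(6)–(7), §3 eqs. (14)–(17); M. Lüscher, Commun. Math. Phys. 293 (2010) 899; Abbott et al., Phys. Rev.
D 106 (2022) 074506, §V.  THE END OF THE CHAIN: every structural hypothesis of the extensive floor is
discharged for the gauged CP(N−1)/O(N) action on the periodic lattice with ARBITRARY transporters
`R_{(x,i)} : E ≃ₗᵢ E` on the links `(x, i) : x → x + e_i` (`κ = Nβ` in E–S's normalisation,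
`d = dim E = 2N ≥ 2`).  What remains is data: a finite family of links `(x_j, i_j)` that are mutually
`Box(2m+2)`-apart, and a flow time `c` small in terms of `(κ, ν, d, m)` only.  Conclusion:
`KL((Φ_{0→c})_*π̄ ‖ e^{−cS}π̄/Z_c) ≥ |T_b|·32κ⁴c⁴/(128(d−1)d²(d+2)) − L^ν·(12κ²(2ν)²/(d−1))c²·2e^{Kc}(Kc)^{m+1}/(m+1)!`,
`K = 6|κ|ν/(d−1)`: for the uncorrected exact leading-order trivializing flow, the reverse relative
entropy to the target — the training objective — grows at least linearly with the number of
far-apart links one can place, i.e. with the volume, at every fixed small flow time.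

## Content

* **`torusLink_pairs_sub_le_klDiv_map_loFlow`** — the displayed inequality.

NOT CLAIMED: the count of a box-apart link family for given `L` (e.g. `(L/s)^ν` for `s ∣ L`,
`s ≥ 2m+4` — arithmetic on `ℤ/L` left to the user); `L ≤ 3`; ESS / acceptance ceilings or
autocorrelations of the Metropolis-corrected chain (the floor concerns the reverse relative entropy);
the rung's numbers.
-/

noncomputable section

namespace Summit.Ventures.LatticeQCDFlow.Exactness

open Function Set Metric MeasureTheory NormedSpace InnerProductSpace InformationTheory
  Literature.MathematicalPhysics.QuantumFieldTheory
open scoped RealInnerProductSpace Topology Nat Classical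

variable {ν L : ℕ} [NeZero L] {E : Type*} [NormedAddCommGroup E] [InnerProductSpace ℝ E]
  [FiniteDimensional ℝ E] [MeasurableSpace E] [BorelSpace E] [Nontrivial E]
  {U : Site ν L → Site ν L → (E →L[ℝ] E)} {T : ℝ}

/-- **THE ENTROPY FLOOR ON `(ℤ/L)^ν` FOR A FAMILY OF FAR-APART COUPLED PAIRS.**  `L ≠ 3`; no
self-coupling, adjoint pairs, nearest-neighbour support, scaled-isometric links; pairs `{k_j, l_j}`
(`j ∈ T_b`) coupled with weight `β₀` and mutually `Box(2(m+1))`-apart; `0 ≤ c ≤ |T| + 1` with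
`4I₀²ρ²c² ≤ A/16`, `I₀μc² ≤ 1`, `Ac⁴ ≤ 64` for `I₀ = 2(2(m+1)+1)^ν`, `ρ = 4|κ|³υ³/(d−1)²`,
`μ = κ²υ²/(d−1)`, `A = 32κ⁴β₀⁴/((d−1)d²(d+2))`.  Then
`|T_b|·A·c⁴/128 − L^ν·12μc²·2e^{Kc}(Kc)^{m+1}/(m+1)! ≤ KL((Φ_{0→c})_*π̄ ‖ π̄.tilted(−cS))`. -/
theorem torus_pairs_sub_le_klDiv_map_loFlow (hL3 : L ≠ 3) (hU0 : ∀ n, U n n = 0)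
    (hUadj : ∀ m n (v w : E), ⟪U m n v, w⟫ = ⟪v, U n m w⟫)
    (hNN : ∀ x y, U x y ≠ 0 → ∃ i : Fin ν, y = x.shift i ∨ x = y.shift i)
    (hd : 2 ≤ Module.finrank ℝ E) (κ S₀ : ℝ) {υ : ℝ} (hυ : ∀ k, ∑ m, ‖U k m‖ ≤ υ)
    {c : ℝ} (hc0 : 0 ≤ c) (hc : c ≤ |T| + 1) {e : Site ν L → E} (he : ∀ n, ‖e n‖ = 1) (m : ℕ)
    {g : Site ν L → (Site ν L → sphere (0 : E) 1) → ℝ}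
    (hg : ∀ n ω, g n ω = -∫ u in (0 : ℝ)..c, u * (2 * κ ^ 2 / ((Module.finrank ℝ E : ℝ) - 1) *
      ‖tangentKick (localField U n (sphereTDFlow (G := fun _ : ℝ => loFlowAction κ S₀ U)
          (contDiff_const_family (contDiff_loFlowAction U κ S₀)) T 0 u
          ((nball (fun k => insert k (couplingNbhd U k)) (m + 1) n).piecewise
            (fun i => ((ω i : sphere (0 : E) 1) : E)) e)))
        (sphereTDFlow (G := fun _ : ℝ => loFlowAction κ S₀ U)
          (contDiff_const_family (contDiff_loFlowAction U κ S₀)) T 0 u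
          ((nball (fun k => insert k (couplingNbhd U k)) (m + 1) n).piecewise
            (fun i => ((ω i : sphere (0 : E) 1) : E)) e) n)‖ ^ 2))
    {β : Site ν L → Site ν L → ℝ} (hβ : ∀ n m (v : E), ‖U n m v‖ = β n m * ‖v‖) {β₀ : ℝ}
    {J : Type*} (Tb : Finset J) (kf lf : J → Site ν L)
    (hcoupled : ∀ j ∈ Tb, U (kf j) (lf j) ≠ 0) (hβ0 : ∀ j ∈ Tb, β (kf j) (lf j) = β₀)
    (hapart : ∀ j ∈ Tb, ∀ j' ∈ Tb, j ≠ j' → ∀ b ∈ ({kf j, lf j} : Finset (Site ν L)),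
      ∀ b' ∈ ({kf j', lf j'} : Finset (Site ν L)),
      b' ∉ (Fintype.piFinset fun _ : Fin ν =>
          Finset.Icc (-((m + 1 + (m + 1) : ℕ) : ℤ)) ((m + 1 + (m + 1) : ℕ) : ℤ)).image
        (fun v : Fin ν → ℤ => b + fun i => ((v i : ℤ) : ZMod L)))
    (hc1 : 4 * (2 * (2 * ((m : ℝ) + 1) + 1) ^ ν) ^ 2 *
        (4 * |κ| ^ 3 * υ ^ 3 / ((Module.finrank ℝ E : ℝ) - 1) ^ 2) ^ 2 * c ^ 2 ≤
      32 * κ ^ 4 * β₀ ^ 4 /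
        (((Module.finrank ℝ E : ℝ) - 1) * (Module.finrank ℝ E : ℝ) ^ 2 * ((Module.finrank ℝ E : ℝ) + 2)) / 16)
    (hc2 : (2 * (2 * ((m : ℝ) + 1) + 1) ^ ν) * (κ ^ 2 * υ ^ 2 / ((Module.finrank ℝ E : ℝ) - 1)) * c ^ 2 ≤ 1)
    (hc3 : 32 * κ ^ 4 * β₀ ^ 4 /
        (((Module.finrank ℝ E : ℝ) - 1) * (Module.finrank ℝ E : ℝ) ^ 2 * ((Module.finrank ℝ E : ℝ) + 2)) *
      c ^ 4 ≤ 64) :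
    (Tb.card : ℝ) * (32 * κ ^ 4 * β₀ ^ 4 /
          (((Module.finrank ℝ E : ℝ) - 1) * (Module.finrank ℝ E : ℝ) ^ 2 * ((Module.finrank ℝ E : ℝ) + 2)) *
        c ^ 4 / 128) -
      Fintype.card (Site ν L) * (12 * κ ^ 2 * υ ^ 2 / ((Module.finrank ℝ E : ℝ) - 1) * c ^ 2 *
        (2 * Real.exp (3 * |κ| * υ / ((Module.finrank ℝ E : ℝ) - 1) * c) *
          (3 * |κ| * υ / ((Module.finrank ℝ E : ℝ) - 1) * c) ^ (m + 1) / ((m + 1)! : ℝ))) ≤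
      (klDiv (Measure.map (sphereTDFlowMap (G := fun _ : ℝ => loFlowAction κ S₀ U)
          (contDiff_const_family (contDiff_loFlowAction U κ S₀)) T 0 c)
          (Measure.pi (fun _ : Site ν L => uniformSphere (volume : Measure E))))
        ((Measure.pi (fun _ : Site ν L => uniformSphere (volume : Measure E))).tilted
          fun ω => -(c * esAction κ S₀ U (fun m => (ω m : E))))).toReal := by
  -- blocks = the pairs; one pair per block
  set B : J → Finset (Site ν L) := fun j => {kf j, lf j} with hBdef
  -- symmetric support from adjoint pairs
  have hsym : ∀ x y, U x y ≠ 0 → U y x ≠ 0 := by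
    intro x y hxy hyx
    apply hxy
    ext v
    have h0 : ∀ w, ⟪U x y v, w⟫ = 0 := fun w => by rw [hUadj x y v w, hyx]; simp
    simpa using h0 (U x y v)
  have hkl : ∀ j ∈ Tb, kf j ≠ lf j := by
    intro j hj h
    exact hcoupled j hj (by rw [h]; exact hU0 _)
  -- pairwise disjoint blocks (a common site would lie in its own box)
  have hB : ∀ j ∈ Tb, ∀ j' ∈ Tb, j ≠ j' → Disjoint (B j) (B j') := by
    intro j hj j' hj' hjj
    rw [Finset.disjoint_left]
    intro b hb hb'
    exact hapart j hj j' hj' hjj b hb b hb' (torus_mem_box_self _ b)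
  have hsep := blocks_separated_of_box_apart (U := U) hNN m Tb B hapart
  have hP : ∀ j ∈ Tb, ∀ P ∈ ({B j} : Finset (Finset (Site ν L))), ∀ P' ∈ ({B j} : Finset (Finset (Site ν L))),
      P ≠ P' → Disjoint P P' := by
    intro j _ P hP P' hP' hne
    rw [Finset.mem_singleton] at hP hP'
    exact absurd (hP.trans hP'.symm) hne
  have hPC : ∀ j ∈ Tb, ∀ P ∈ ({B j} : Finset (Finset (Site ν L))), Disjoint P (Finset.univ \ Tb.biUnion B) := by
    intro j hj P hP
    rw [Finset.mem_singleton] at hP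
    subst hP
    rw [Finset.disjoint_left]
    intro b hb hb'
    rw [Finset.mem_sdiff] at hb'
    exact hb'.2 (Finset.mem_biUnion.2 ⟨j, hj, hb⟩)
  have hpair : ∀ j ∈ Tb, ∀ P ∈ ({B j} : Finset (Finset (Site ν L))), ∃ k l, P = {k, l} ∧ k ≠ l ∧
      k ∈ B j ∧ l ∈ B j ∧ (∀ n, U n k = 0 ∨ U n l = 0) ∧ β k l = β₀ := by
    intro j hj P hP
    rw [Finset.mem_singleton] at hP
    refine ⟨kf j, lf j, hP, hkl j hj, by simp [hBdef], by simp [hBdef],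
      torus_pair_no_common_neighbour hL3 U hU0 hNN hsym (hcoupled j hj), hβ0 j hj⟩
  have hn : ∀ j ∈ Tb, (1 : ℝ) ≤ (({B j} : Finset (Finset (Site ν L))).card : ℝ) := by
    intro j _; simp
  have hI : ∀ j ∈ Tb, ((Finset.univ.filter (fun n =>
      ¬ Disjoint (nball (fun k => insert k (couplingNbhd U k)) (m + 1) n) ↑(B j))).card : ℝ) ≤
      2 * (2 * ((m : ℝ) + 1) + 1) ^ ν := by
    intro j hj
    have h1 := card_coneNbhd_le (U := U) hNN m (B j)
    have h2 : (B j).card ≤ 2 := by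
      rw [hBdef]
      exact Finset.card_insert_le _ _ |>.trans (by simp)
    have h3 : (Finset.univ.filter (fun n =>
        ¬ Disjoint (nball (fun k => insert k (couplingNbhd U k)) (m + 1) n) ↑(B j))).card ≤
        2 * (2 * (m + 1) + 1) ^ ν :=
      h1.trans (Nat.mul_le_mul_right _ h2)
    exact_mod_cast h3
  have h := card_mul_pow_four_sub_le_klDiv_map_loFlow hU0 hUadj hd κ S₀ hυ hc0 hc he m hg Tb B hB hsep
    (fun j => {B j}) hP hPC hβ hpair zero_le_one hn hI (by simpa only [one_mul] using hc1) hc2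
    (by simpa only [one_mul] using hc3) (T := T)
  simpa only [one_mul] using h

/-- **THE ENTROPY FLOOR FOR THE LINK-TRANSPORTED CP(N−1)/O(N) COUPLING ON `(ℤ/L)^ν`, `L ≥ 4`.**
Arbitrary link isometries `R`; `d = dim E ≥ 2`; a finite family of links `(x_j, i_j)`, `j ∈ T_b`,
mutually `Box(2(m+1))`-apart; `0 ≤ c ≤ |T| + 1` small for `(κ, ν, d, m)` (three explicit conditions,
`υ = 2ν`, `β₀ = 1`, `I₀ = 2(2m+3)^ν`).  Then
`|T_b|·32κ⁴c⁴/(128(d−1)d²(d+2)) − L^ν·(12κ²(2ν)²/(d−1))c²·2e^{Kc}(Kc)^{m+1}/(m+1)! ≤ KL((Φ_{0→c})_*π̄ ‖ π̄.tilted(−cS))`,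
`K = 3|κ|(2ν)/(d−1)`. -/
theorem torusLink_pairs_sub_le_klDiv_map_loFlow (hL : 4 ≤ L) (R : Site ν L × Fin ν → (E ≃ₗᵢ[ℝ] E))
    (hd : 2 ≤ Module.finrank ℝ E) (κ S₀ : ℝ)
    {c : ℝ} (hc0 : 0 ≤ c) (hc : c ≤ |T| + 1) {e : Site ν L → E} (he : ∀ n, ‖e n‖ = 1) (m : ℕ)
    {g : Site ν L → (Site ν L → sphere (0 : E) 1) → ℝ}
    (hg : ∀ n ω, g n ω = -∫ u in (0 : ℝ)..c, u * (2 * κ ^ 2 / ((Module.finrank ℝ E : ℝ) - 1) *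
      ‖tangentKick (localField (linkCoupling (fun ℓ : Site ν L × Fin ν => ℓ.1) (fun ℓ => ℓ.1.shift ℓ.2) R) n
        (sphereTDFlow (G := fun _ : ℝ => loFlowAction κ S₀
          (linkCoupling (fun ℓ : Site ν L × Fin ν => ℓ.1) (fun ℓ => ℓ.1.shift ℓ.2) R))
          (contDiff_const_family (contDiff_loFlowAction
            (linkCoupling (fun ℓ : Site ν L × Fin ν => ℓ.1) (fun ℓ => ℓ.1.shift ℓ.2) R) κ S₀)) T 0 u
          ((nball (fun k => insert k (couplingNbhd
            (linkCoupling (fun ℓ : Site ν L × Fin ν => ℓ.1) (fun ℓ => ℓ.1.shift ℓ.2) R) k)) (m + 1) n).piecewise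
            (fun i => ((ω i : sphere (0 : E) 1) : E)) e)))
        (sphereTDFlow (G := fun _ : ℝ => loFlowAction κ S₀
          (linkCoupling (fun ℓ : Site ν L × Fin ν => ℓ.1) (fun ℓ => ℓ.1.shift ℓ.2) R))
          (contDiff_const_family (contDiff_loFlowAction
            (linkCoupling (fun ℓ : Site ν L × Fin ν => ℓ.1) (fun ℓ => ℓ.1.shift ℓ.2) R) κ S₀)) T 0 u
          ((nball (fun k => insert k (couplingNbhd
            (linkCoupling (fun ℓ : Site ν L × Fin ν => ℓ.1) (fun ℓ => ℓ.1.shift ℓ.2) R) k)) (m + 1) n).piecewise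
            (fun i => ((ω i : sphere (0 : E) 1) : E)) e) n)‖ ^ 2))
    {J : Type*} (Tb : Finset J) (xf : J → Site ν L) (dir : J → Fin ν)
    (hapart : ∀ j ∈ Tb, ∀ j' ∈ Tb, j ≠ j' → ∀ b ∈ ({xf j, (xf j).shift (dir j)} : Finset (Site ν L)),
      ∀ b' ∈ ({xf j', (xf j').shift (dir j')} : Finset (Site ν L)),
      b' ∉ (Fintype.piFinset fun _ : Fin ν =>
          Finset.Icc (-((m + 1 + (m + 1) : ℕ) : ℤ)) ((m + 1 + (m + 1) : ℕ) : ℤ)).image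
        (fun v : Fin ν → ℤ => b + fun i => ((v i : ℤ) : ZMod L)))
    (hc1 : 4 * (2 * (2 * ((m : ℝ) + 1) + 1) ^ ν) ^ 2 *
        (4 * |κ| ^ 3 * (2 * (ν : ℝ)) ^ 3 / ((Module.finrank ℝ E : ℝ) - 1) ^ 2) ^ 2 * c ^ 2 ≤
      32 * κ ^ 4 /
        (((Module.finrank ℝ E : ℝ) - 1) * (Module.finrank ℝ E : ℝ) ^ 2 * ((Module.finrank ℝ E : ℝ) + 2)) / 16)
    (hc2 : (2 * (2 * ((m : ℝ) + 1) + 1) ^ ν) * (κ ^ 2 * (2 * (ν : ℝ)) ^ 2 / ((Module.finrank ℝ E : ℝ) - 1)) *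
      c ^ 2 ≤ 1)
    (hc3 : 32 * κ ^ 4 /
        (((Module.finrank ℝ E : ℝ) - 1) * (Module.finrank ℝ E : ℝ) ^ 2 * ((Module.finrank ℝ E : ℝ) + 2)) *
      c ^ 4 ≤ 64) :
    (Tb.card : ℝ) * (32 * κ ^ 4 /
          (((Module.finrank ℝ E : ℝ) - 1) * (Module.finrank ℝ E : ℝ) ^ 2 * ((Module.finrank ℝ E : ℝ) + 2)) *
        c ^ 4 / 128) -
      Fintype.card (Site ν L) *
        (12 * κ ^ 2 * (2 * (ν : ℝ)) ^ 2 / ((Module.finrank ℝ E : ℝ) - 1) * c ^ 2 *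
        (2 * Real.exp (3 * |κ| * (2 * (ν : ℝ)) / ((Module.finrank ℝ E : ℝ) - 1) * c) *
          (3 * |κ| * (2 * (ν : ℝ)) / ((Module.finrank ℝ E : ℝ) - 1) * c) ^ (m + 1) / ((m + 1)! : ℝ))) ≤
      (klDiv (Measure.map (sphereTDFlowMap (G := fun _ : ℝ => loFlowAction κ S₀
          (linkCoupling (fun ℓ : Site ν L × Fin ν => ℓ.1) (fun ℓ => ℓ.1.shift ℓ.2) R))
          (contDiff_const_family (contDiff_loFlowAction
            (linkCoupling (fun ℓ : Site ν L × Fin ν => ℓ.1) (fun ℓ => ℓ.1.shift ℓ.2) R) κ S₀)) T 0 c)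
          (Measure.pi (fun _ : Site ν L => uniformSphere (volume : Measure E))))
        ((Measure.pi (fun _ : Site ν L => uniformSphere (volume : Measure E))).tilted
          fun ω => -(c * esAction κ S₀
            (linkCoupling (fun ℓ : Site ν L × Fin ν => ℓ.1) (fun ℓ => ℓ.1.shift ℓ.2) R) (fun m => (ω m : E))))).toReal := by
  have hL3 : 3 ≤ L := by omega
  have hL3' : L ≠ 3 := by omega
  have hU0 := torusLink_self R hL3
  have hUadj : ∀ m n (v w : E),
      ⟪linkCoupling (fun ℓ : Site ν L × Fin ν => ℓ.1) (fun ℓ => ℓ.1.shift ℓ.2) R m n v, w⟫ =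
        ⟪v, linkCoupling (fun ℓ : Site ν L × Fin ν => ℓ.1) (fun ℓ => ℓ.1.shift ℓ.2) R n m w⟫ :=
    fun m n v w => inner_linkCoupling _ _ R m n v w
  have hNN := torusLink_ne_zero_imp_nn (ν := ν) (L := L) R
  have hβ : ∀ n m (v : E),
      ‖linkCoupling (fun ℓ : Site ν L × Fin ν => ℓ.1) (fun ℓ => ℓ.1.shift ℓ.2) R n m v‖ =
        (fun n m : Site ν L => if ∃ i : Fin ν, m = n.shift i ∨ n = m.shift i then (1 : ℝ) else 0) n m *
          ‖v‖ := fun n m v => norm_torusLink_apply R hL3 n m v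
  have hυ := sum_norm_torusLink_le R hL3
  have hcoupled : ∀ j ∈ Tb,
      linkCoupling (fun ℓ : Site ν L × Fin ν => ℓ.1) (fun ℓ => ℓ.1.shift ℓ.2) R (xf j)
        ((fun j => (xf j).shift (dir j)) j) ≠ 0 := by
    intro j _ h
    obtain ⟨v, hv⟩ := exists_ne (0 : E)
    have h1 := congrArg (fun A : E →L[ℝ] E => A v) h
    simp only [zero_apply] at h1
    rw [torusLink_apply_shift R hL3] at h1
    have hn := (R (xf j, dir j)).symm.norm_map v
    rw [h1, norm_zero] at hn
    exact hv (norm_eq_zero.1 hn.symm)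
  have hβ0 : ∀ j ∈ Tb,
      (fun n m : Site ν L => if ∃ i : Fin ν, m = n.shift i ∨ n = m.shift i then (1 : ℝ) else 0) (xf j)
        ((fun j => (xf j).shift (dir j)) j) = 1 := by
    intro j _
    simp only
    rw [if_pos ⟨dir j, Or.inl rfl⟩]
  have h := torus_pairs_sub_le_klDiv_map_loFlow hL3' hU0 hUadj hNN hd κ S₀ hυ hc0 hc he m hg hβ Tb xf
    (fun j => (xf j).shift (dir j)) hcoupled hβ0 hapart (by simpa only [one_pow, mul_one] using hc1) hc2
    (by simpa only [one_pow, mul_one] using hc3) (T := T)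
  simpa only [one_pow, mul_one] using h

end Summit.Ventures.LatticeQCDFlow.Exactness

end
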